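import Summits.ValiantsHypothesis.ValiantsHypothesis.Theorems.BarrierLeverAnchoredDoorHitsLowerPairsThinSide
import Summits.ValiantsHypothesis.ValiantsHypothesis.Theorems.BarrierLeverPartitionMinorsHitByVPLayoutSwap

/-!
# Support item `AnchoredDoorHitsLowerPairs` (stmt-ValiantsHypothesis-22510), line `anchored-peeling`:
# the `x ↔ y` SYMMETRY of the symbolic anchored minor, and the thin side for COLUMNS

Helper file (`--supports stmt-ValiantsHypothesis-22510`; cell valiant-natproofs, rung V4, 𝒟-side door (c); registered line
`Cruxes/AnchoredDoorHitsLowerPairs/Lines/anchored_peeling.lean` v3; prover seat val-np-p4 gen 16). One bookkeeping `def` (`paramSwap`,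
the involution of the parameter index exchanging the two sides of every anchor and the two kinds of twists). Closes NO item.

* `swap_symbolicWitness`: flipping the variables `x_a ↔ y_a` (`LayoutSwap.flipVars`, val-np-p1) and renaming the parameters by
  `paramSwap` maps the symbolic anchored witness 𝔄_s to itself (the anchor set is symmetric).
* `symbolicDet_swap`: `symbolicDet s h r u w = rename paramSwap (symbolicDet s h r w u)` — the symbolic minor of the transposed
  layout is the renamed symbolic minor; hence (`symbolicDet_ne_zero_swap`, `symbolicDet_ne_zero_comm`) non-vanishing is symmetric in
  rows and columns. Every statement of the line about rows (star steps with `|Z| ≤ s`, thin rows, rigid pairs) transfers to columns.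
* `symbolicDet_ne_zero_of_card_le_col`, `anchoredHit_of_card_le_col`: the THIN SIDE for columns — for every `s ≥ 1`, EVERY `h`,
  injective `u, w` with all COLUMNS of size `≤ s` (rows arbitrary) and matched emptiness, `symbolicDet s h r u w ≠ 0`
  (from `ProductRule.symbolicDet_ne_zero_of_card_le`).

WHAT THIS IS NOT: nothing on thick × thick pairs (`stub_rigidPairs`); nothing on items 22510 / 19717 themselves, on crux
stmt-ValiantsHypothesis-14610, or on `VP` versus `VNP`.
-/

set_option linter.dupNamespace false

namespace Summit.ValiantsHypothesis.ValiantsHypothesis.Theorems.BarrierLever.AnchoredPeeling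

open Finset MvPolynomial
open Summit.ValiantsHypothesis.ValiantsHypothesis.Theorems.BarrierLever.BrickCalculus (pexpo pexpo_def)
open Summit.ValiantsHypothesis.ValiantsHypothesis.Theorems.BarrierLever.LayoutSwap
  (flipVars flipVars_castAdd flipVars_natAdd mapDomain_flipVars)

noncomputable section

variable {h : ℕ}

/-- The parameter involution: `θ_(A|B) ↦ θ_(B|A)`, `φ_{(A|B), b} ↦ ψ_{(B|A), b}`, `ψ_{(A|B), d} ↦ φ_{(B|A), d}`. -/
def paramSwap (h : ℕ) : Param h → Param h
  | Sum.inl α => Sum.inl α.swap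
  | Sum.inr (Sum.inl (α, b)) => Sum.inr (Sum.inr (α.swap, b))
  | Sum.inr (Sum.inr (α, d)) => Sum.inr (Sum.inl (α.swap, d))

/-- `paramSwap` is an involution. -/
theorem paramSwap_paramSwap (p : Param h) : paramSwap h (paramSwap h p) = p := by
  rcases p with α | ⟨α, b⟩ | ⟨α, d⟩ <;> simp [paramSwap]

/-- `paramSwap` is injective. -/
theorem paramSwap_injective : Function.Injective (paramSwap h) :=
  Function.LeftInverse.injective paramSwap_paramSwap

/-- The swap on one anchor factor: flip the variables, rename the parameters — the factor of the swapped anchor. -/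
theorem swap_symbFactor (α : Finset (Fin h) × Finset (Fin h)) :
    MvPolynomial.map (rename (paramSwap h)).toRingHom (rename (flipVars h) (symbFactor h α)) = symbFactor h α.swap := by
  rw [symbFactor, symbFactor]
  simp only [map_add, map_one, map_mul, map_prod, rename_C, rename_X, map_C, map_X, AlgHom.toRingHom_eq_coe,
    RingHom.coe_coe, flipVars_castAdd, flipVars_natAdd, Prod.fst_swap, Prod.snd_swap]
  simp only [paramSwap]
  ring

/-- The anchor set is symmetric. -/
theorem swap_mem_anchors_iff (s h : ℕ) (α : Finset (Fin h) × Finset (Fin h)) :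
    α ∈ anchors s h ↔ α.swap ∈ anchors s h := by
  simp only [anchors, Finset.mem_filter, Finset.mem_univ, true_and, Prod.fst_swap, Prod.snd_swap]
  tauto

/-- **The symbolic anchored witness is swap-invariant.** -/
theorem swap_symbolicWitness (s h : ℕ) :
    MvPolynomial.map (rename (paramSwap h)).toRingHom (rename (flipVars h) (symbolicWitness s h)) = symbolicWitness s h := by
  rw [symbolicWitness_eq_prod, map_prod, map_prod]
  simp_rw [swap_symbFactor]
  exact Finset.prod_equiv (Equiv.prodComm _ _) (fun α => by rw [Equiv.prodComm_apply]; exact swap_mem_anchors_iff s h α)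
    (fun α _ => rfl)

/-- Entries of the transposed layout are the renamed entries. -/
theorem coeff_symbolicWitness_swap (s h : ℕ) (U W : Finset (Fin h)) :
    coeff (pexpo U W) (symbolicWitness s h) = rename (paramSwap h) (coeff (pexpo W U) (symbolicWitness s h)) := by
  conv_lhs => rw [← swap_symbolicWitness s h]
  rw [coeff_map, AlgHom.toRingHom_eq_coe, RingHom.coe_coe, pexpo_def, ← mapDomain_flipVars U W,
    coeff_rename_mapDomain _ (flipVars h).injective, ← pexpo_def]

/-- **Swap formula:** the symbolic minor of `(u, w)` is the renamed symbolic minor of the transposed layout `(w, u)`. -/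
theorem symbolicDet_swap (s h r : ℕ) (u w : Fin r → Finset (Fin h)) :
    symbolicDet s h r u w = rename (paramSwap h) (symbolicDet s h r w u) := by
  have h1 : symbolicDet s h r w u = (Matrix.of fun i j : Fin r => coeff (pexpo (w i) (u j)) (symbolicWitness s h)).det := rfl
  have h2 : symbolicDet s h r u w = (Matrix.of fun i j : Fin r => coeff (pexpo (u i) (w j)) (symbolicWitness s h)).det := rfl
  rw [h1, h2, AlgHom.map_det, ← Matrix.det_transpose]
  congr 1
  ext i j
  rw [Matrix.transpose_apply, AlgHom.mapMatrix_apply, Matrix.map_apply, Matrix.of_apply, Matrix.of_apply,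
    coeff_symbolicWitness_swap]

/-- Non-vanishing transfers from the transposed layout. -/
theorem symbolicDet_ne_zero_swap (s h r : ℕ) (u w : Fin r → Finset (Fin h)) (hne : symbolicDet s h r w u ≠ 0) :
    symbolicDet s h r u w ≠ 0 := by
  rw [symbolicDet_swap]
  intro h0
  exact hne (rename_injective _ paramSwap_injective (by rw [h0, map_zero]))

/-- Non-vanishing of the symbolic minor is symmetric in rows and columns. -/
theorem symbolicDet_ne_zero_comm (s h r : ℕ) (u w : Fin r → Finset (Fin h)) :
    symbolicDet s h r u w ≠ 0 ↔ symbolicDet s h r w u ≠ 0 :=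
  ⟨symbolicDet_ne_zero_swap s h r w u, symbolicDet_ne_zero_swap s h r u w⟩

namespace ProductRule

/-- **THE THIN-SIDE THEOREM (columns).** For every `s ≥ 1`, EVERY `h`, injective `u, w` with all COLUMNS of size `≤ s` (rows
arbitrary) and matched emptiness, `symbolicDet s h r u w ≠ 0`. -/
theorem symbolicDet_ne_zero_of_card_le_col (s h r : ℕ) (hs : 1 ≤ s) (u w : Fin r → Finset (Fin h))
    (hu : Function.Injective u) (hw : Function.Injective w) (hthin : ∀ j, (w j).card ≤ s)
    (hempty : (∃ i, u i = ∅) ↔ (∃ j, w j = ∅)) : symbolicDet s h r u w ≠ 0 :=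
  symbolicDet_ne_zero_swap s h r u w (symbolicDet_ne_zero_of_card_le s h r hs w u hw hu hthin hempty.symm)

/-- Lower-set form for columns: the registered stub `stub_symbolicNonvanishing` holds, for every `s ≥ 1` from `h₀ = 0`, on every
injective simplicial-complex pair whose COLUMN complex has dimension `≤ s − 1`. -/
theorem symbolicDet_ne_zero_of_card_le_col_of_lowerSets (s h r : ℕ) (hs : 1 ≤ s) (u w : Fin r → Finset (Fin h))
    (hu : Function.Injective u) (hw : Function.Injective w) (hlu : IsLowerSet (Set.range u))
    (hlw : IsLowerSet (Set.range w)) (hthin : ∀ j, (w j).card ≤ s) : symbolicDet s h r u w ≠ 0 :=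
  symbolicDet_ne_zero_of_card_le_col s h r hs u w hu hw hthin (empty_iff_of_lowerSets u w hlu hlw)

/-- Every thin-column layout with matched emptiness is an anchored hit. -/
theorem anchoredHit_of_card_le_col (s h r : ℕ) (hs : 1 ≤ s) (u w : Fin r → Finset (Fin h))
    (hu : Function.Injective u) (hw : Function.Injective w) (hthin : ∀ j, (w j).card ≤ s)
    (hempty : (∃ i, u i = ∅) ↔ (∃ j, w j = ∅)) : AnchoredHit s h r u w :=
  stub_genericPoint s h r u w (symbolicDet_ne_zero_of_card_le_col s h r hs u w hu hw hthin hempty)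

end ProductRule

end

end Summit.ValiantsHypothesis.ValiantsHypothesis.Theorems.BarrierLever.AnchoredPeeling
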